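import Summits.QuantumAdvantage.QuantumAdvantage.Theorems.CubicForrelationNearExactIsExactCubicFormRadical
import Summits.QuantumAdvantage.QuantumAdvantage.Theorems.CubicForrelationNearExactIsExactTwelveTypeOWindowPrep

/-!
# Crux `CubicForrelation.NearExactIsExact` (stmt-QuantumAdvantage-14043) — SUBADDITIVITY OF THE RANK of alternating forms over `𝔽₂`,
  in the frame language (any number of bits)

Certificate seat `b2b-cforr-cert` (gen 41).  HONEST FRAMING: kernel-checked elementary counting (standard axioms, Mathlib + the tree's
bit-vector language only), on top of …CubicFormRadical (`tce_radical_card`: `#Rad B = 2^{n−2h}` for a maximal frame of size `h`).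
It is the "subadditivity of rank" step of the L2 cell lemma of the light-cell analysis of `E1280-even`
(HOME/b2b-cforr-cert-g39/E1280-HANDPROOFS.md App. A.4: the two halves `f|_{s₀=0}`, `f|_{s₀=1}` of a cell with cubic form `s₀ ∧ ω`
have alternating parts `β` and `β ⊕ ω`, of ranks `2h₀, 2h₁` with `h₀ + h₁ ≥ rank ω / 2`).  Nothing about `θ₁₂`; NOT summit progress.

* (uses …TwelveTypeOWindowPrep `to12_card_mul_le`: for `⊕`-closed `U, W ⊆ 𝔽₂ⁿ`, `#U · #W ≤ 2ⁿ · #(U ∩ W)`.)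
* `tce_radical_closed`: the radical of a first-slot-additive form is `⊕`-closed and contains `0`.
* `tce_rank_subadd` (**main**): if `B₁`, `B₂` and `B₁ ⊕ B₂` have maximal frames of sizes `h₁`, `h₂`, `h₃`, then `h₃ ≤ h₁ + h₂`
  (`Rad B₁ ∩ Rad B₂ ⊆ Rad(B₁ ⊕ B₂)` and the radical counts).
* `tce_form_zero_of_frame_zero`: a maximal frame of size `0` means `B ≡ 0`.

References: F. J. MacWilliams, N. J. A. Sloane (1977) Ch. 15 §2.  Axioms: the standard three.
-/

set_option linter.dupNamespace false -- D-0017: single-problem summit ⇒ `QuantumAdvantage.QuantumAdvantage` by design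

namespace Summit.QuantumAdvantage.QuantumAdvantage.Theorems.CubicForrelation.NearExactIsExact

open Finset
open Literature.Computability.QuantumComplexity.BuzetChailloux (bxor zeroVec bxor_comm bxor_self bxor_zeroVec zeroVec_bxor
  bxor_bxor_cancel_left)

variable {n : ℕ}

/-- The radical of a first-slot-additive form is closed under `⊕` and contains `0`. [folklore] -/
theorem tce_radical_closed (B : (Fin n → Bool) → (Fin n → Bool) → Bool) (hadd : ∀ x y z, B (bxor x y) z = (B x z ^^ B y z)) :
    (zeroVec ∈ (univ.filter fun x : Fin n → Bool => ∀ y, B x y = false)) ∧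
      ∀ x ∈ (univ.filter fun x : Fin n → Bool => ∀ y, B x y = false), ∀ x' ∈ (univ.filter fun x : Fin n → Bool => ∀ y, B x y = false),
        bxor x x' ∈ (univ.filter fun x : Fin n → Bool => ∀ y, B x y = false) := by
  refine ⟨mem_filter.2 ⟨mem_univ _, fun y => ?_⟩, fun x hx x' hx' => mem_filter.2 ⟨mem_univ _, fun y => ?_⟩⟩
  · have e := hadd y y y
    rw [bxor_self] at e
    rw [e]; cases B y y <;> rfl
  · rw [hadd, (mem_filter.1 hx).2 y, (mem_filter.1 hx').2 y]; rfl

/-- A maximal frame of size `0` means the form vanishes identically. [folklore] -/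
theorem tce_form_zero_of_frame_zero (B : (Fin n → Bool) → (Fin n → Bool) → Bool) (b c : Fin 0 → (Fin n → Bool))
    (hmax : ∀ x y, (∀ i, B x (b i) = false) → (∀ i, B x (c i) = false) → (∀ i, B y (b i) = false) → (∀ i, B y (c i) = false) →
      B x y = false) (x y : Fin n → Bool) : B x y = false :=
  hmax x y (fun i => Fin.elim0 i) (fun i => Fin.elim0 i) (fun i => Fin.elim0 i) (fun i => Fin.elim0 i)

/-- **Subadditivity of the rank.**  Let `B₁`, `B₂` be symmetric first-slot-additive forms on `𝔽₂ⁿ` with maximal frames of sizes `h₁`,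
`h₂`, and let the form `B₁ ⊕ B₂` have a maximal frame of size `h₃`.  Then `h₃ ≤ h₁ + h₂`.
[folklore; cite: MacWilliamsSloane1977, Ch. 15 §2] -/
theorem tce_rank_subadd (B₁ B₂ : (Fin n → Bool) → (Fin n → Bool) → Bool)
    (hsymm₁ : ∀ x y, B₁ x y = B₁ y x) (hadd₁ : ∀ x y z, B₁ (bxor x y) z = (B₁ x z ^^ B₁ y z))
    (hsymm₂ : ∀ x y, B₂ x y = B₂ y x) (hadd₂ : ∀ x y z, B₂ (bxor x y) z = (B₂ x z ^^ B₂ y z))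
    (h₁ : ℕ) (b₁ c₁ : Fin h₁ → (Fin n → Bool))
    (hbc₁ : ∀ i, B₁ (b₁ i) (c₁ i) = true) (hbc₁' : ∀ i j, i ≠ j → B₁ (b₁ i) (c₁ j) = false) (hbb₁ : ∀ i j, B₁ (b₁ i) (b₁ j) = false)
    (hmax₁ : ∀ x y, (∀ i, B₁ x (b₁ i) = false) → (∀ i, B₁ x (c₁ i) = false) → (∀ i, B₁ y (b₁ i) = false) →
      (∀ i, B₁ y (c₁ i) = false) → B₁ x y = false)
    (h₂ : ℕ) (b₂ c₂ : Fin h₂ → (Fin n → Bool))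
    (hbc₂ : ∀ i, B₂ (b₂ i) (c₂ i) = true) (hbc₂' : ∀ i j, i ≠ j → B₂ (b₂ i) (c₂ j) = false) (hbb₂ : ∀ i j, B₂ (b₂ i) (b₂ j) = false)
    (hmax₂ : ∀ x y, (∀ i, B₂ x (b₂ i) = false) → (∀ i, B₂ x (c₂ i) = false) → (∀ i, B₂ y (b₂ i) = false) →
      (∀ i, B₂ y (c₂ i) = false) → B₂ x y = false)
    (h₃ : ℕ) (b₃ c₃ : Fin h₃ → (Fin n → Bool))
    (hbc₃ : ∀ i, (B₁ (b₃ i) (c₃ i) ^^ B₂ (b₃ i) (c₃ i)) = true)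
    (hbc₃' : ∀ i j, i ≠ j → (B₁ (b₃ i) (c₃ j) ^^ B₂ (b₃ i) (c₃ j)) = false)
    (hbb₃ : ∀ i j, (B₁ (b₃ i) (b₃ j) ^^ B₂ (b₃ i) (b₃ j)) = false)
    (hmax₃ : ∀ x y, (∀ i, (B₁ x (b₃ i) ^^ B₂ x (b₃ i)) = false) → (∀ i, (B₁ x (c₃ i) ^^ B₂ x (c₃ i)) = false) →
      (∀ i, (B₁ y (b₃ i) ^^ B₂ y (b₃ i)) = false) → (∀ i, (B₁ y (c₃ i) ^^ B₂ y (c₃ i)) = false) → (B₁ x y ^^ B₂ x y) = false) :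
    h₃ ≤ h₁ + h₂ := by
  classical
  set B₃ : (Fin n → Bool) → (Fin n → Bool) → Bool := fun x y => B₁ x y ^^ B₂ x y with hB₃
  have hsymm₃ : ∀ x y, B₃ x y = B₃ y x := fun x y => by rw [hB₃]; simp only; rw [hsymm₁, hsymm₂]
  have hadd₃ : ∀ x y z, B₃ (bxor x y) z = (B₃ x z ^^ B₃ y z) := fun x y z => by
    rw [hB₃]; simp only; rw [hadd₁, hadd₂]
    cases B₁ x z <;> cases B₁ y z <;> cases B₂ x z <;> cases B₂ y z <;> rfl
  obtain ⟨hle₁, hR₁⟩ := tce_radical_card B₁ hsymm₁ hadd₁ h₁ b₁ c₁ hbc₁ hbc₁' hbb₁ hmax₁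
  obtain ⟨hle₂, hR₂⟩ := tce_radical_card B₂ hsymm₂ hadd₂ h₂ b₂ c₂ hbc₂ hbc₂' hbb₂ hmax₂
  obtain ⟨hle₃, hR₃⟩ := tce_radical_card B₃ hsymm₃ hadd₃ h₃ b₃ c₃ hbc₃ hbc₃' hbb₃ hmax₃
  -- `Rad B₁ ∩ Rad B₂ ⊆ Rad B₃`
  have hsub : (univ.filter fun x : Fin n → Bool => ∀ y, B₁ x y = false) ∩ (univ.filter fun x : Fin n → Bool => ∀ y, B₂ x y = false) ⊆
      (univ.filter fun x : Fin n → Bool => ∀ y, B₃ x y = false) := by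
    intro x hx
    obtain ⟨hx₁, hx₂⟩ := mem_inter.1 hx
    refine mem_filter.2 ⟨mem_univ _, fun y => ?_⟩
    rw [hB₃]; simp only
    rw [(mem_filter.1 hx₁).2 y, (mem_filter.1 hx₂).2 y]; rfl
  have hinter := to12_card_mul_le _ _ (tce_radical_closed B₁ hadd₁).2 (tce_radical_closed B₂ hadd₂).2
  rw [hR₁, hR₂] at hinter
  have hle : 2 ^ (n - 2 * h₁) * 2 ^ (n - 2 * h₂) ≤ 2 ^ n * 2 ^ (n - 2 * h₃) := by
    refine hinter.trans ?_
    rw [← hR₃]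
    exact Nat.mul_le_mul_left _ (card_le_card hsub)
  rw [← pow_add, ← pow_add] at hle
  have hexp := (Nat.pow_le_pow_iff_right (by norm_num : 1 < 2)).1 hle
  omega

end Summit.QuantumAdvantage.QuantumAdvantage.Theorems.CubicForrelation.NearExactIsExact
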